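import Mathlib
import Summits.MatrixMultiplication.Statement
import Summits.MatrixMultiplication.MatrixMultiplication.Theorems.GraphEquationsSecondOrderSeparation
import Summits.MatrixMultiplication.MatrixMultiplication.Theorems.GraphEquationsCorankUnmasking
import Summits.MatrixMultiplication.MatrixMultiplication.Theorems.GraphEquationsCubicRefutation
import Summits.MatrixMultiplication.MatrixMultiplication.Theorems.GraphEquationsCubicDictionaryConverse

/-!
# The depth ladder: the horizontal dial as a finite-dimensional statement (`GraphEquations`, M62)

Decomp-mm node «GraphEquations» (lens 5, g42); attacked leaf `MultiplicityReduction`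
(stmt-MatrixMultiplication-27806).  Target VERBATIM: `_root_.MatrixMultiplication`.  Route-neutral: the
cut `closes (hV) (hM)` is untouched; this file only relates DIALS that live in Theorems.

The purification-depth dial `HorizontalUnmask d n` (M60b) and its bilinear core
`SecondOrderSeparation s n` (M61) quantify over correct CUBIC EQUATION SYSTEMS and their affine normal
forms.  Here they are identified with clean statements about affine systems `(κ, L_A, L_B, M)` alone —
exactly as `C3ₙ ⟺ AQRₙ` (M43/M44) — and placed on one ladder with the corank dial of M52:

* `DepthBound n d` / `SepBound n s` (affine level) and **`horizontalUnmask_iff_depthBound`,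
  `secondOrderSeparation_iff_sepBound`** (every `n`; realisation `exists_eqSystem_of_affSystem`, M44).
* RUNG 0 IS `AQRₙ`: `depthBound_zero_iff`, hence **`not_depthBound_zero`, `not_horizontalUnmask_zero`**
  for `n ≥ 2` (M51b) — the dial has content only from `d = 1` on (`depthBound_one_iff`: the two-round
  form of the cell's question (Q*)).
* THE LADDER `CorankBound n c → SepBound n c → DepthBound n (c + 1)` (`sepBound_of_corankBound`,
  `depthBound_of_sepBound`; a spanning family of the kernel separates at second order,
  `Correct.secondOrderSeparates_of_mem_span`), monotone (`DepthBound.mono`, `SepBound.mono`), with the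
  unconditional tops `sepBound_sq`, `depthBound_sq_succ`.  So the depth dial is implied by EVERY corank
  dial, while the converse fails as badly as possible on the pivot designs (corank `≥ n^{3/2}/4` at every
  base, M55, yet depth `1`, M57): depth is the strictly finer currency, and the linear corank dial is
  refuted (M55) without touching `DepthBound n 1`.
* `cubicEquationsForceMultiplication_of_depthBound`: `(∀ n ≥ 3, DepthBound n d) → CEFM` for fixed `d`.
Sources: [BurgisserClausenShokrollahi1997, (15.1), Problem 16.3]; [Strassen1973]; the cell's M43–M61.
-/

-- dupNamespace: forced by the nested Summit.MatrixMultiplication.MatrixMultiplication layout (D-0017)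
set_option linter.dupNamespace false

noncomputable section

namespace Summit.MatrixMultiplication.MatrixMultiplication.Theorems.GraphEquations

open Matrix Module

variable {n : ℕ}

namespace AffSystem

variable {S : AffSystem n}

/-! ## Small flats -/

/-- A flat with no directions is the base point. -/
theorem persistsAlongFlat_zero_iff {A B : Vec n} (U V : Fin 0 → Vec n) {δ : Vec n} :
    S.PersistsAlongFlat A B U V δ ↔ S.IsKer A B δ := by
  simp [PersistsAlongFlat]

/-- A flat with one direction is a line. -/
theorem persistsAlongFlat_one_iff {A B : Vec n} (U V : Fin 1 → Vec n) {δ : Vec n} :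
    S.PersistsAlongFlat A B U V δ ↔ S.PersistsAlong A B (U 0) (V 0) δ := by
  constructor
  · intro h
    have := h.line (fun _ => 1)
    simpa using this
  · intro h t
    have := h (t 0)
    simpa [PersistsAlongFlat] using this

/-- Padding a flat with zero directions does not change persistence. -/
theorem PersistsAlongFlat.of_append_zero {d k : ℕ} {A B : Vec n} {U V : Fin d → Vec n} {δ : Vec n}
    (h : S.PersistsAlongFlat A B (Fin.append U (fun _ : Fin k => 0))
      (Fin.append V (fun _ : Fin k => 0)) δ) :
    S.PersistsAlongFlat A B U V δ := by
  intro t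
  have := h (Fin.append t (fun _ : Fin k => 0))
  simpa [Fin.sum_univ_add] using this

/-! ## A spanning family of the kernel separates at second order -/

/-- If the `W_j` span the kernel at `(A,B)`, they separate it at second order: a kernel vector with
`δᵀ M_i W_j = 0` for all `i, j` has all kernel quadrics `δᵀ M_i δ = 0`, so vanishes by correctness. -/
theorem Correct.secondOrderSeparates_of_mem_span (hC : S.Correct) {A B : Vec n} {s : ℕ}
    {W : Fin s → Vec n} (hW : ∀ δ, S.IsKer A B δ → δ ∈ Submodule.span ℂ (Set.range W)) :
    S.SecondOrderSeparates A B W := by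
  intro δ hK h
  refine hC.eq_zero_of_isKer_of_quad hK fun i => ?_
  have key : ∀ w ∈ Submodule.span ℂ (Set.range W), ((S.test i).M *ᵥ w) ⬝ᵥ δ = 0 := by
    intro w hw
    induction hw using Submodule.span_induction with
    | mem x hx =>
      obtain ⟨j, rfl⟩ := hx
      exact h i j
    | zero => simp
    | add x y _ _ hx hy => simp [Matrix.mulVec_add, add_dotProduct, hx, hy]
    | smul a x _ hx => simp [Matrix.mulVec_smul, smul_dotProduct, hx]
  exact key δ (hW δ hK)

/-- A kernel of dimension `≤ c` is spanned by a family indexed by `Fin c`. -/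
theorem exists_spanning_of_finrank_le {A B : Vec n} {c : ℕ}
    (hc : finrank ℂ (S.kerSpace A B) ≤ c) :
    ∃ W : Fin c → Vec n, ∀ δ, S.IsKer A B δ → δ ∈ Submodule.span ℂ (Set.range W) := by
  classical
  set K := S.kerSpace A B
  let b := Module.finBasis ℂ K
  refine ⟨fun i => if h : (i : ℕ) < finrank ℂ K then ((b ⟨i, h⟩ : K) : Vec n) else 0,
    fun δ hδ => ?_⟩
  have hδK : δ ∈ K := S.mem_kerSpace.2 hδ
  have hsum : δ = ∑ a, b.repr ⟨δ, hδK⟩ a • ((b a : K) : Vec n) := by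
    have h1 := congrArg K.subtype (b.sum_repr ⟨δ, hδK⟩).symm
    simp only [map_sum, map_smul, Submodule.subtype_apply] at h1
    exact h1
  rw [hsum]
  refine Submodule.sum_mem _ fun a _ => Submodule.smul_mem _ _ (Submodule.subset_span
    ⟨⟨a, lt_of_lt_of_le a.2 hc⟩, ?_⟩)
  simp

/-- **Corank `≤ c` at a base gives `c` second-order separating matrices there.** -/
theorem Correct.exists_secondOrderSeparates_of_finrank_le (hC : S.Correct) {A B : Vec n} {c : ℕ}
    (hc : finrank ℂ (S.kerSpace A B) ≤ c) :
    ∃ W : Fin c → Vec n, S.SecondOrderSeparates A B W := by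
  obtain ⟨W, hW⟩ := exists_spanning_of_finrank_le hc
  exact ⟨W, hC.secondOrderSeparates_of_mem_span hW⟩

/-- **Corank `≤ c` at a base gives purification depth `≤ c + 1` there.** -/
theorem Correct.exists_flat_of_finrank_le (hC : S.Correct) {A B : Vec n} {c : ℕ}
    (hc : finrank ℂ (S.kerSpace A B) ≤ c) :
    ∃ U V : Fin (c + 1) → Vec n, ∀ δ, S.PersistsAlongFlat A B U V δ → δ = 0 := by
  obtain ⟨W, hW⟩ := hC.exists_secondOrderSeparates_of_finrank_le hc
  exact ⟨snocDirA W, snocDirB n c, fun δ hδ => eq_zero_of_persistsAlongFlat_snoc hW hδ⟩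

end AffSystem

/-! ## The affine-level dials -/

/-- **`DepthBound n d`.**  Every correct AFFINE system for `W_n` has a base and `d` directions along
whose flat no nonzero kernel vector persists (purification depth `≤ d`).  `d = 0` is `AQRₙ`. -/
def DepthBound (n d : ℕ) : Prop :=
  ∀ S : AffSystem n, S.Correct →
    ∃ (A B : Vec n) (U V : Fin d → Vec n), ∀ δ, S.PersistsAlongFlat A B U V δ → δ = 0

/-- **`SepBound n s`.**  Every correct AFFINE system for `W_n` has a base and `s` matrices separating
its kernel at second order. -/
def SepBound (n s : ℕ) : Prop :=
  ∀ S : AffSystem n, S.Correct → ∃ (A B : Vec n) (W : Fin s → Vec n), S.SecondOrderSeparates A B W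

/-- Rung `0` of the depth dial is `AQRₙ`. -/
theorem depthBound_zero_iff : DepthBound n 0 ↔ AffSystem.AffineQuadricRigidity n := by
  refine forall₂_congr fun S _ => ⟨?_, ?_⟩
  · rintro ⟨A, B, U, V, h⟩
    exact ⟨A, B, fun δ hδ => h δ ((AffSystem.persistsAlongFlat_zero_iff U V).2 hδ)⟩
  · rintro ⟨A, B, h⟩
    exact ⟨A, B, fun i => i.elim0, fun i => i.elim0,
      fun δ hδ => h δ ((AffSystem.persistsAlongFlat_zero_iff _ _).1 hδ)⟩

/-- **Rung `0` is false for `n ≥ 2`** (the masked square system, M51b). -/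
theorem not_depthBound_zero (hn : 2 ≤ n) : ¬ DepthBound n 0 :=
  fun h => not_affineQuadricRigidity hn (depthBound_zero_iff.1 h)

/-- Rung `1` is the two-round statement of the cell's question (Q*). -/
theorem depthBound_one_iff :
    DepthBound n 1 ↔ ∀ S : AffSystem n, S.Correct → ∃ A B U V : Vec n, (S.happend₂ U V).ReducedAt A B := by
  refine forall₂_congr fun S _ => ⟨?_, ?_⟩
  · rintro ⟨A, B, U, V, h⟩
    exact ⟨A, B, U 0, V 0, AffSystem.reducedAt_happend₂_iff.2 fun δ hδ =>
      h δ ((AffSystem.persistsAlongFlat_one_iff U V).2 hδ)⟩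
  · rintro ⟨A, B, U, V, h⟩
    exact ⟨A, B, fun _ => U, fun _ => V, fun δ hδ =>
      AffSystem.reducedAt_happend₂_iff.1 h δ
        ((AffSystem.persistsAlongFlat_one_iff (fun _ : Fin 1 => U) (fun _ : Fin 1 => V)).1 hδ)⟩

/-- Monotonicity (additive form). -/
theorem DepthBound.add {d : ℕ} (h : DepthBound n d) (k : ℕ) : DepthBound n (d + k) := by
  intro S hS
  obtain ⟨A, B, U, V, hUV⟩ := h S hS
  exact ⟨A, B, Fin.append U (fun _ => 0), Fin.append V (fun _ => 0),
    fun δ hδ => hUV δ hδ.of_append_zero⟩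

/-- **Monotonicity of the depth dial.** -/
theorem DepthBound.mono {d d' : ℕ} (h : DepthBound n d) (hdd' : d ≤ d') : DepthBound n d' := by
  obtain ⟨k, rfl⟩ := Nat.exists_eq_add_of_le hdd'
  exact h.add k

/-- Monotonicity of the separation dial (pad with zero matrices). -/
theorem SepBound.mono {s s' : ℕ} (h : SepBound n s) (hss' : s ≤ s') : SepBound n s' := by
  obtain ⟨k, rfl⟩ := Nat.exists_eq_add_of_le hss'
  intro S hS
  obtain ⟨A, B, W, hW⟩ := h S hS
  refine ⟨A, B, Fin.append W (fun _ : Fin k => 0), fun δ hK hδ => hW δ hK fun i j => ?_⟩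
  have := hδ i (Fin.castAdd k j)
  simpa using this

/-- **The ladder, step 1: `CorankBound n c → SepBound n c`.** -/
theorem sepBound_of_corankBound {c : ℕ} (h : CorankBound n c) : SepBound n c := by
  intro S hS
  obtain ⟨A, B, hc⟩ := h S hS
  obtain ⟨W, hW⟩ := hS.exists_secondOrderSeparates_of_finrank_le hc
  exact ⟨A, B, W, hW⟩

/-- **The ladder, step 2: `SepBound n s → DepthBound n (s + 1)`.** -/
theorem depthBound_of_sepBound {s : ℕ} (h : SepBound n s) : DepthBound n (s + 1) := by
  intro S hS
  obtain ⟨A, B, W, hW⟩ := h S hS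
  exact ⟨A, B, AffSystem.snocDirA W, AffSystem.snocDirB n s,
    fun δ hδ => AffSystem.eq_zero_of_persistsAlongFlat_snoc hW hδ⟩

/-- `CorankBound n c → DepthBound n (c + 1)`: every corank dial implies a depth dial. -/
theorem depthBound_of_corankBound {c : ℕ} (h : CorankBound n c) : DepthBound n (c + 1) :=
  depthBound_of_sepBound (sepBound_of_corankBound h)

/-- Unconditional top of the separation dial: `SepBound n (n²)`. -/
theorem sepBound_sq (n : ℕ) : SepBound n (n * n) := sepBound_of_corankBound corankBound_sq

/-- Unconditional top of the depth dial: `DepthBound n (n² + 1)`. -/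
theorem depthBound_sq_succ (n : ℕ) : DepthBound n (n * n + 1) := depthBound_of_corankBound corankBound_sq

/-! ## The equation-system dials ARE the affine dials -/

/-- `DepthBound n d → HorizontalUnmask d n` (the affine normal form of a correct cubic system is a
correct affine system, M43). -/
theorem horizontalUnmask_of_depthBound {d : ℕ} (h : DepthBound n d) : HorizontalUnmask d n :=
  fun _ hE _ _ hg => h _ (affSystemOf_correct hE hg)

/-- `SepBound n s → SecondOrderSeparation s n`. -/
theorem secondOrderSeparation_of_sepBound {s : ℕ} (h : SepBound n s) : SecondOrderSeparation s n :=
  fun _ hE _ _ hg => h _ (affSystemOf_correct hE hg)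

/-- Realisation data: a correct affine system is the affine normal form of a correct cubic equation
system whose tests are among its own (M44 `exists_eqSystem_of_affSystem`). -/
theorem exists_realisation (S : AffSystem n) (hS : S.Correct) :
    ∃ E : EqSystem n, E.Correct ∧ E.IsCubic ∧ ∃ σ : Fin E.tests.length → Fin S.m,
      ∀ o A B C, MvPolynomial.eval (pt A B C) (E.testPoly (E.tests.get o)) =
        (S.test (σ o)).eval A B C := by
  obtain ⟨E, hfan, hto, hfrom⟩ := exists_eqSystem_of_affSystem S
  have hto' : ∀ o : Fin E.tests.length, ∃ o', E.testPoly (E.tests.get o) = (S.test o').poly :=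
    fun o => hto _ (List.get_mem _ _)
  choose σ hσ using hto'
  refine ⟨E, correct_of_realises hS hfan hto hfrom, isCubic_of_realises hto, σ, fun o A B C => ?_⟩
  rw [hσ o, AffTest.eval_pt_poly]

/-- **`HorizontalUnmask d n → DepthBound n d`** (every `n`). -/
theorem depthBound_of_horizontalUnmask {d : ℕ} (h : HorizontalUnmask d n) : DepthBound n d := by
  intro S hS
  obtain ⟨E, hE, hc, σ, hσ⟩ := exists_realisation S hS
  obtain ⟨A, B, U, V, hUV⟩ := h E hE hc (fun o => S.test (σ o)) hσ
  exact ⟨A, B, U, V, fun δ hδ => hUV δ fun t o => hδ t (σ o)⟩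

/-- **`SecondOrderSeparation s n → SepBound n s`** (every `n`). -/
theorem sepBound_of_secondOrderSeparation {s : ℕ} (h : SecondOrderSeparation s n) : SepBound n s := by
  intro S hS
  obtain ⟨E, hE, hc, σ, hσ⟩ := exists_realisation S hS
  obtain ⟨A, B, W, hW⟩ := h E hE hc (fun o => S.test (σ o)) hσ
  exact ⟨A, B, W, fun δ hK hδ => hW δ (fun o => hK (σ o)) fun o j => hδ (σ o) j⟩

/-- **The equation-system depth dial is the affine depth dial**: `HorizontalUnmask d n ↔ DepthBound n d`. -/
theorem horizontalUnmask_iff_depthBound {d : ℕ} : HorizontalUnmask d n ↔ DepthBound n d :=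
  ⟨depthBound_of_horizontalUnmask, horizontalUnmask_of_depthBound⟩

/-- `SecondOrderSeparation s n ↔ SepBound n s`. -/
theorem secondOrderSeparation_iff_sepBound {s : ℕ} : SecondOrderSeparation s n ↔ SepBound n s :=
  ⟨sepBound_of_secondOrderSeparation, secondOrderSeparation_of_sepBound⟩

/-- **Rung `0` of the horizontal dial is false for `n ≥ 2`.** -/
theorem not_horizontalUnmask_zero (hn : 2 ≤ n) : ¬ HorizontalUnmask 0 n :=
  fun h => not_depthBound_zero hn (depthBound_of_horizontalUnmask h)

/-- `HorizontalUnmask d n` holds for `n ≤ 1` and every `d` (`AQR₀`, `AQR₁`). -/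
theorem horizontalUnmask_of_le_one (hn : n ≤ 1) (d : ℕ) : HorizontalUnmask d n :=
  horizontalUnmask_of_depthBound
    ((depthBound_zero_iff.2 (corankBound_zero_iff.1 (corankBound_zero_of_le_one hn))).mono d.zero_le)

/-- **`(∀ n ≥ 3, DepthBound n d) → CubicEquationsForceMultiplication`** for every FIXED `d`. -/
theorem cubicEquationsForceMultiplication_of_depthBound (d : ℕ)
    (h : ∀ n : ℕ, 3 ≤ n → DepthBound n d) : CubicEquationsForceMultiplication :=
  cubicEquationsForceMultiplication_of_horizontalUnmask d
    fun n hn => horizontalUnmask_of_depthBound (h n hn)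

/-- **`(∀ n ≥ 3, SepBound n s) → CubicEquationsForceMultiplication`** for every FIXED `s`. -/
theorem cubicEquationsForceMultiplication_of_sepBound (s : ℕ)
    (h : ∀ n : ℕ, 3 ≤ n → SepBound n s) : CubicEquationsForceMultiplication :=
  cubicEquationsForceMultiplication_of_depthBound (s + 1) fun n hn => depthBound_of_sepBound (h n hn)

end Summit.MatrixMultiplication.MatrixMultiplication.Theorems.GraphEquations

end
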